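import Summits.AtomisticToContinuum.Crystallization.Theorems.FrustratedLawDichotomyMotifDoorE

/-!
# FrustratedLawDichotomy · crux `AperiodicFrustratedLawGap` (stmt-AtomisticToContinuum-27623) — PERIODIC-BLOCK NEGATIVE KERNEL, part A:
# range-level goodness transfer, translation invariance, re-indexing, lattice coordinates
# (decomp-a2c, prover hand 2, structural share, generation 15; DEF-light; critic rows 543 (B3) / 544 (C) / 548)

The Schur-cut residuals `T′♭ / FRG♭ / E′♭` (`…SchurCut`) are inequalities `Σ_i level_i ≤ U_W(y) − A·N` over ALL finite injective `7/10`-separated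
clusters.  A PERIODIC adversary (hand-1 g14's all-strained cells, lens-5's (O4′) rows) refutes such a law through its `n³`-BLOCKS: interior sites
carry the periodic site energy and the periodic goodness flags exactly (finite range, locality of the two-shell predicate), boundary sites are
`O(n²)`.  This part supplies the block-independent tools; part B (`…PeriodicBlockKernel`) builds the blocks and proves the violation.

* §1 RANGE-LEVEL TRANSFER of the two-shell predicate between a configuration `y` and a sub-configuration `z` (`range z ⊆ range y`) that contains
  every atom of `y` within `ϱ ≥ 13/10·D + 1` of the common centre: `goodAt_of_subconfig` (`GoodAtScale η D z c → GoodAt η y i`) and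
  `maybeGood_of_goodAt_subconfig` (`GoodAt η y i → MaybeGoodAt η D z c`, `η ≤ 3/10`) — the `φ`-free forms of `…MotifLemmas.goodAt_of_motif` /
  `…MotifDoorE.maybeGood_of_goodAt`;
* §2 TRANSLATION: `goodAtScale_translate`, `maybeGoodAt_translate(_iff)` — the flags of `z + w` at `c` are those of `z`;
* §3 RE-INDEXING a cluster by an arbitrary `Fintype` (`y = Y ∘ e.symm`, `e : ι ≃ Fin N`): `sep_reindex`, `goodCount_reindex`
  (`goodCount η y = #{p : ι // GoodAt η y (e p)}`), `interactionEnergy_reindex` (`2·U_W(y) = Σ_p Σ_q W(|Y p − Y q|) − N·W 0`);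
* §4 INTEGER LATTICE VECTORS `latVec a t = Σ_k t_k • a_k` and the dual-basis coordinate bound `abs_coord_le_of_dual`
  (`⟪b_j, a_k⟫ = δ_jk ⟹ |t_j| ≤ ‖b_j‖·‖latVec a t‖`), `latVec` additivity.

All `[folklore]`; 0 sorry.
-/

noncomputable section

namespace Summit.AtomisticToContinuum.Crystallization.Theorems.FrustratedLawDichotomyPeriodicBlockGeometry

open scoped BigOperators Classical
open Metric
open Literature.MathematicalPhysics.StatisticalMechanics (interactionEnergy lennardJones two_mul_interactionEnergy_eq_sum_sum_sub)
open Summit.AtomisticToContinuum.Crystallization.Theorems.ChargedEnergyGapNegative (E3)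
open Summit.AtomisticToContinuum.Crystallization.Theorems.FrustratedLawDichotomyRangeCut
open Summit.AtomisticToContinuum.Crystallization.Theorems.FrustratedLawDichotomyMotifLemmas
open Summit.AtomisticToContinuum.Crystallization.Theorems.FrustratedLawDichotomyMotifDoorE

/-! ## §1. Range-level transfer of the two-shell predicate -/

/-- **A capped-good centre of a deep sub-configuration is good in the configuration** (range form of `goodAt_of_motif`): `range z ⊆ range y`,
every atom of `y` within `ϱ` of `y i` lies in `range z`, `z c = y i`, `13/10·D + 1 ≤ ϱ`. [folklore] -/
theorem goodAt_of_subconfig {η D ϱ : ℝ} {N M : ℕ} {y : Fin N → E3} {z : Fin M → E3} {i : Fin N} {c : Fin M}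
    (hsub : Set.range z ⊆ Set.range y) (hball : ∀ s ∈ Set.range y, dist s (y i) ≤ ϱ → s ∈ Set.range z) (hc : z c = y i)
    (hdeep : 13 / 10 * D + 1 ≤ ϱ) (h : GoodAtScale η D z c) : GoodAt η y i := by
  obtain ⟨d, η', γ, A, hdD, hor⟩ := h
  rw [hc] at hor
  refine ⟨d, η', min γ 1, A, ?_⟩
  rcases hor with ⟨t, h⟩ | ⟨t, h⟩
  · have hdeep' : 13 / 10 * d + 1 ≤ ϱ := by have := h.1; nlinarith
    exact Or.inl ⟨t, clauses_extend (fun u : ↥Literature.Geometry.DiscreteGeometry.fccKissingPattern => (u : E3)) hsub hball hdeep' h⟩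
  · have hdeep' : 13 / 10 * d + 1 ≤ ϱ := by have := h.1; nlinarith
    exact Or.inr ⟨t, clauses_extend (fun u : ↥Literature.Geometry.DiscreteGeometry.hcpKissingPattern => (u : E3)) hsub hball hdeep' h⟩

/-- **Capped goodness restricts to a deep sub-configuration** (range form of `goodAtScale_restrict`, `η ≤ 3/10`). [folklore] -/
theorem goodAtScale_of_subconfig {η D ϱ : ℝ} {N M : ℕ} {y : Fin N → E3} {z : Fin M → E3} {i : Fin N} {c : Fin M}
    (hsub : Set.range z ⊆ Set.range y) (hball : ∀ s ∈ Set.range y, dist s (y i) ≤ ϱ → s ∈ Set.range z) (hc : z c = y i)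
    (hdeep : 13 / 10 * D + 1 ≤ ϱ) (hη : η ≤ 3 / 10) (h : GoodAtScale η D y i) : GoodAtScale η D z c := by
  obtain ⟨d, η', γ, A, hdD, hor⟩ := h
  refine ⟨d, η', γ, A, hdD, ?_⟩
  rw [hc]
  show (∃ t, _) ∨ (∃ t, _)
  rcases hor with ⟨t, h⟩ | ⟨t, h⟩
  · exact Or.inl ⟨t, clauses_restrict (fun u : ↥Literature.Geometry.DiscreteGeometry.fccKissingPattern => (u : E3)) norm_fccPattern
      hsub hball hdeep hdD hη h⟩
  · exact Or.inr ⟨t, clauses_restrict (fun u : ↥Literature.Geometry.DiscreteGeometry.hcpKissingPattern => (u : E3)) norm_hcpPattern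
      hsub hball hdeep hdD hη h⟩

/-- **Good in the configuration ⟹ maybe-good in every deep sub-configuration** (range form of `maybeGood_of_goodAt`; `z` injective, `η ≤ 3/10`).
Contrapositive use: a sub-configuration certified NOT maybe-good certifies the site BAD. [folklore] -/
theorem maybeGood_of_goodAt_subconfig {η D ϱ : ℝ} {N M : ℕ} {y : Fin N → E3} {z : Fin M → E3} (hz : Function.Injective z)
    {i : Fin N} {c : Fin M}
    (hsub : Set.range z ⊆ Set.range y) (hball : ∀ s ∈ Set.range y, dist s (y i) ≤ ϱ → s ∈ Set.range z) (hc : z c = y i)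
    (hdeep : 13 / 10 * D + 1 ≤ ϱ) (hη : η ≤ 3 / 10) (h : GoodAt η y i) : MaybeGoodAt η D z c := by
  obtain ⟨d, η', γ, A, hor⟩ := h
  have hpin : ∀ s : E3, s ∈ Set.range y → s ≠ y i → d ≤ dist s (y i) := by
    rcases hor with ⟨t, -, -, -, -, h1, -, -⟩ | ⟨t, -, -, -, -, h1, -, -⟩ <;> exact h1
  by_cases hdD : d ≤ D
  · exact Or.inl (goodAtScale_of_subconfig hsub hball hc hdeep hη ⟨d, η', γ, A, hdD, hor⟩)
  · right
    intro a hac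
    have hne : z a ≠ y i := fun h => hac (hz (h.trans hc.symm))
    have := hpin (z a) (hsub ⟨a, rfl⟩) hne
    push Not at hdD
    rw [hc]
    linarith

/-! ## §2. Translation invariance of the capped two-shell predicate -/

/-- The clause list of the fit predicate is invariant under translating the point set, the centre and the matched atoms by `w`. [folklore] -/
theorem clauses_translate {P : Type*} (v : P → E3) {X : Set E3} {p : E3} (w : E3) {d η' ηmax γ : ℝ} {A : E3 →ₗᵢ[ℝ] E3} {t : P → E3}
    (h : 0 < d ∧ 0 < γ ∧ η' < ηmax ∧ (∀ u, t u ∈ X ∧ ‖(t u - p) - d • A (v u)‖ ≤ η' * d) ∧ (∀ s, s ∈ X → s ≠ p → d ≤ dist s p) ∧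
      (∃ s, s ∈ X ∧ s ≠ p ∧ dist s p ≤ d) ∧ (∀ s, s ∈ X → s ≠ p → dist s p < 13 / 10 * d + γ → dist s p ≤ 13 / 10 * d - γ ∧ s ∈ Set.range t)) :
    0 < d ∧ 0 < γ ∧ η' < ηmax ∧ (∀ u, (t u + w) ∈ (· + w) '' X ∧ ‖((t u + w) - (p + w)) - d • A (v u)‖ ≤ η' * d) ∧
      (∀ s, s ∈ (· + w) '' X → s ≠ p + w → d ≤ dist s (p + w)) ∧
      (∃ s, s ∈ (· + w) '' X ∧ s ≠ p + w ∧ dist s (p + w) ≤ d) ∧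
      (∀ s, s ∈ (· + w) '' X → s ≠ p + w → dist s (p + w) < 13 / 10 * d + γ →
        dist s (p + w) ≤ 13 / 10 * d - γ ∧ s ∈ Set.range (fun u => t u + w)) := by
  obtain ⟨hd, hγ, hη, ht, hnn₁, hnn₂, hgap⟩ := h
  have hsub : ∀ u, (t u + w) - (p + w) = t u - p := fun u => by abel
  refine ⟨hd, hγ, hη, fun u => ⟨⟨t u, (ht u).1, rfl⟩, by rw [hsub]; exact (ht u).2⟩, ?_, ?_, ?_⟩
  · rintro _ ⟨s, hs, rfl⟩ hsp
    have hsp' : s ≠ p := fun h => hsp (by rw [h])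
    have := hnn₁ s hs hsp'
    rwa [dist_add_right]
  · obtain ⟨s, hs, hsp, hle⟩ := hnn₂
    exact ⟨s + w, ⟨s, hs, rfl⟩, fun h => hsp (add_right_cancel h), by rwa [dist_add_right]⟩
  · rintro _ ⟨s, hs, rfl⟩ hsp hlt
    have hsp' : s ≠ p := fun h => hsp (by rw [h])
    rw [dist_add_right] at hlt ⊢
    obtain ⟨h1, ⟨u, hu⟩⟩ := hgap s hs hsp' hlt
    exact ⟨h1, ⟨u, by simp only [hu]⟩⟩

/-- The range of a translated configuration. [folklore] -/
theorem range_translate {M : ℕ} (z : Fin M → E3) (w : E3) : Set.range (fun a => z a + w) = (· + w) '' Set.range z := by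
  ext s
  simp only [Set.mem_range, Set.mem_image, exists_exists_eq_and]

/-- **`GoodAtScale` is translation invariant**: `GoodAtScale η D z c → GoodAtScale η D (z + w) c`. [folklore] -/
theorem goodAtScale_translate {η D : ℝ} {M : ℕ} {z : Fin M → E3} {c : Fin M} (w : E3) (h : GoodAtScale η D z c) :
    GoodAtScale η D (fun a => z a + w) c := by
  obtain ⟨d, η', γ, A, hdD, hor⟩ := h
  refine ⟨d, η', γ, A, hdD, ?_⟩
  rw [range_translate]
  show (∃ t, _) ∨ (∃ t, _)
  rcases hor with ⟨t, h⟩ | ⟨t, h⟩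
  · exact Or.inl ⟨fun u => t u + w, clauses_translate (fun u : ↥Literature.Geometry.DiscreteGeometry.fccKissingPattern => (u : E3)) w h⟩
  · exact Or.inr ⟨fun u => t u + w, clauses_translate (fun u : ↥Literature.Geometry.DiscreteGeometry.hcpKissingPattern => (u : E3)) w h⟩

/-- **`MaybeGoodAt` is translation invariant** (one direction). [folklore] -/
theorem maybeGoodAt_translate {η D : ℝ} {M : ℕ} {z : Fin M → E3} {c : Fin M} (w : E3) (h : MaybeGoodAt η D z c) :
    MaybeGoodAt η D (fun a => z a + w) c := by
  rcases h with h | h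
  · exact Or.inl (goodAtScale_translate w h)
  · right
    intro a hac
    rw [dist_add_right]
    exact h a hac

/-- **`MaybeGoodAt` is translation invariant** (iff). [folklore] -/
theorem maybeGoodAt_translate_iff {η D : ℝ} {M : ℕ} {z : Fin M → E3} {c : Fin M} (w : E3) :
    MaybeGoodAt η D (fun a => z a + w) c ↔ MaybeGoodAt η D z c := by
  refine ⟨fun h => ?_, maybeGoodAt_translate w⟩
  have := maybeGoodAt_translate (-w) h
  simp only [add_neg_cancel_right] at this
  exact this

/-! ## §3. Re-indexing a cluster by an arbitrary finite type -/

/-- Separation is invariant under re-indexing. [folklore] -/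
theorem sep_reindex {ι : Type*} {N : ℕ} (e : ι ≃ Fin N) {Y : ι → E3}
    (hsep : ∀ p q : ι, p ≠ q → (7 : ℝ) / 10 ≤ dist (Y p) (Y q)) : Sep (Y ∘ e.symm) :=
  fun _ _ hab => hsep _ _ fun h => hab (e.symm.injective h)

/-- Injectivity is invariant under re-indexing. [folklore] -/
theorem injective_reindex {ι : Type*} {N : ℕ} (e : ι ≃ Fin N) {Y : ι → E3} (hY : Function.Injective Y) :
    Function.Injective (Y ∘ e.symm) :=
  hY.comp e.symm.injective

/-- The range is invariant under re-indexing. [folklore] -/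
theorem range_reindex {ι : Type*} {N : ℕ} (e : ι ≃ Fin N) (Y : ι → E3) : Set.range (Y ∘ e.symm) = Set.range Y :=
  e.symm.surjective.range_comp Y

/-- **The good count, re-indexed**: `goodCount η (Y ∘ e.symm) = #{p : ι // GoodAt η (Y ∘ e.symm) (e p)}`. [folklore] -/
theorem goodCount_reindex {ι : Type*} [Fintype ι] {N : ℕ} (e : ι ≃ Fin N) (Y : ι → E3) (η : ℝ) :
    (goodCount η (Y ∘ e.symm) : ℝ) = ∑ p : ι, (if GoodAt η (Y ∘ e.symm) (e p) then (1 : ℝ) else 0) := by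
  rw [FrustratedLawDichotomyLocalPricing.goodCount_eq_sum]
  exact (e.sum_comp (fun i => if GoodAt η (Y ∘ e.symm) i then (1 : ℝ) else 0)).symm

/-- **The pair energy, re-indexed**: `2·U_W(Y ∘ e.symm) = Σ_p Σ_q W(|Y p − Y q|) − N·W 0`. [folklore] -/
theorem interactionEnergy_reindex {ι : Type*} [Fintype ι] {N : ℕ} (e : ι ≃ Fin N) (Y : ι → E3) (W : ℝ → ℝ) :
    2 * interactionEnergy W (Y ∘ e.symm) = (∑ p : ι, ∑ q : ι, W (dist (Y p) (Y q))) - N * W 0 := by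
  rw [two_mul_interactionEnergy_eq_sum_sum_sub]
  congr 1
  rw [← e.sum_comp (fun i => ∑ j, W (dist ((Y ∘ e.symm) i) ((Y ∘ e.symm) j)))]
  refine Finset.sum_congr rfl fun p _ => ?_
  rw [← e.sum_comp (fun j => W (dist ((Y ∘ e.symm) (e p)) ((Y ∘ e.symm) j)))]
  simp only [Function.comp_apply, Equiv.symm_apply_apply]

/-- `N = |ι|` under `e : ι ≃ Fin N`. [folklore] -/
theorem card_reindex {ι : Type*} [Fintype ι] {N : ℕ} (e : ι ≃ Fin N) : Fintype.card ι = N := by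
  rw [Fintype.card_congr e, Fintype.card_fin]

/-! ## §4. Integer lattice vectors and the dual-basis coordinate bound -/

/-- **`latVec a t = Σ_k t_k • a_k`** — the lattice vector with integer coordinates `t` in the cell basis `a`. -/
def latVec (a : Fin 3 → E3) (t : Fin 3 → ℤ) : E3 := ∑ k, ((t k : ℤ) : ℝ) • a k

/-- Additivity. [folklore] -/
theorem latVec_add (a : Fin 3 → E3) (t t' : Fin 3 → ℤ) : latVec a (t + t') = latVec a t + latVec a t' := by
  simp only [latVec, Pi.add_apply, Int.cast_add, add_smul, Finset.sum_add_distrib]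

/-- Negation. [folklore] -/
theorem latVec_neg (a : Fin 3 → E3) (t : Fin 3 → ℤ) : latVec a (-t) = -latVec a t := by
  simp only [latVec, Pi.neg_apply, Int.cast_neg, neg_smul, Finset.sum_neg_distrib]

/-- Subtraction. [folklore] -/
theorem latVec_sub (a : Fin 3 → E3) (t t' : Fin 3 → ℤ) : latVec a (t - t') = latVec a t - latVec a t' := by
  rw [sub_eq_add_neg, latVec_add, latVec_neg, ← sub_eq_add_neg]

/-- `latVec a 0 = 0`. [folklore] -/
theorem latVec_zero (a : Fin 3 → E3) : latVec a 0 = 0 := by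
  simp [latVec]

/-- **Dual-basis coordinate bound**: if `⟪b j, a k⟫ = δ_jk` then `t_j = ⟪b_j, latVec a t⟫`, hence `|t_j| ≤ ‖b_j‖·‖latVec a t‖`. [folklore] -/
theorem abs_coord_le_of_dual {a b : Fin 3 → E3} (hdual : ∀ j k, inner ℝ (b j) (a k) = if j = k then (1 : ℝ) else 0)
    (t : Fin 3 → ℤ) (j : Fin 3) : |((t j : ℤ) : ℝ)| ≤ ‖b j‖ * ‖latVec a t‖ := by
  have hcoord : inner ℝ (b j) (latVec a t) = ((t j : ℤ) : ℝ) := by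
    simp only [latVec, inner_sum, inner_smul_right, hdual]
    simp [Finset.sum_ite_eq, Finset.mem_univ]
  rw [← hcoord]
  exact abs_real_inner_le_norm (b j) (latVec a t)

/-- **Uniform form**: with `‖b j‖ ≤ cB` for all `j`, `|t_j| ≤ cB·‖latVec a t‖`. [folklore] -/
theorem abs_coord_le_of_dual' {a b : Fin 3 → E3} {cB : ℝ} (hdual : ∀ j k, inner ℝ (b j) (a k) = if j = k then (1 : ℝ) else 0)
    (hb : ∀ j, ‖b j‖ ≤ cB) (t : Fin 3 → ℤ) (j : Fin 3) : |((t j : ℤ) : ℝ)| ≤ cB * ‖latVec a t‖ :=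
  (abs_coord_le_of_dual hdual t j).trans (mul_le_mul_of_nonneg_right (hb j) (norm_nonneg _))

end Summit.AtomisticToContinuum.Crystallization.Theorems.FrustratedLawDichotomyPeriodicBlockGeometry

end
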